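import Mathlib
import HarnessLib
import Summits.Langlands.Langlands.Theses.TorsionKudlaMillsonWindow

/-!
# TorsionKudlaMillsonWindow — proof of the glue `WindowDichotomy` (stmt-Langlands-13535)

`WindowDichotomy : ThetaVisibleConjA → FTraceCongruenceGeneration → EisensteinConjA → ConjAWindowTheta`
(route-Langlands-TorsionKudlaMillsonWindow, binder `dich` of its deciding theorem `closes`).

The SPECIAL/GENERIC DICHOTOMY of the route, proved outright.  Fix the window datum
`(F, K, σ, a, b)`, the division algebra `B = (a', b')_K`, a finite commutative ring `A` and an
additive eigen-character `c : B^× → A` of the unit group `Γ = O^×` (`IsG`), trivial on the centre.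
* SPECIAL (theta-visible) cell: `c γ ≠ 0` for some norm-one unit `γ ∈ Γ` of infinite order with
  reduced trace in `F` — then `ThetaVisibleConjA` is exactly the claim.
* GENERIC cell: `c` kills every such `γ`.  The coordinate order `O = O_K⟨1, i, j, k⟩` is closed
  under multiplication (the coordinates of a product are `O_K`-bilinear in the coordinates, because
  `a', b' ∈ O_F ⊆ O_K`: `equivTuple_mul_mem`), so `Γ = {u : IsG u}` is a subgroup containing every
  generator of the subgroup of `FTraceCongruenceGeneration` (theta-visible units and commutators
  of `Γ`); `c` is additive on `Γ`, hence `c 1 = 0`, `c u⁻¹ = - c u`, `c [u, v] = 0`, and by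
  closure induction `c` kills that subgroup, hence the norm-one principal congruence subgroup
  `Γ¹(N)` — and `EisensteinConjA` is exactly the claim.
Exhaustion is excluded middle.  No definition, no named unproved fact as a hypothesis, no `sorry`.
References: Vignéras, *Arithmétique des algèbres de quaternions*, LNM 800 (1980), Ch. I §4 and
Ch. III §5 (orders and their unit groups) [VignerasLNM800]; Shimura, *Introduction to the
arithmetic theory of automorphic functions* (1971), §8.3 [Shimura1971].
-/

set_option linter.dupNamespace false

namespace Summit.Langlands.Langlands.Theorems.TorsionKudlaMillsonWindowDichotomy

open NumberField
open Summit.Langlands.Langlands.Theses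
open Summit.Langlands.Langlands.Theses.TorsionKudlaMillsonWindow

/-- The unit quaternion `1 = (1, 0, 0, 0)` has coordinates in any subring. [folklore] -/
theorem equivTuple_one_mem {R : Type*} [CommRing R] (S : Subring R) (c₁ c₂ c₃ : R) :
    ∀ i, QuaternionAlgebra.equivTuple c₁ c₂ c₃ 1 i ∈ S := by
  intro i
  fin_cases i <;> simp [QuaternionAlgebra.equivTuple_apply]

/-- **The coordinate order is multiplicatively closed.**  If the structure constants `c₁, c₂, c₃`
of the quaternion algebra `(c₁, c₂, c₃)_R` lie in a subring `S ⊆ R`, then so do the coordinates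
(in the basis `1, i, j, k`) of the product of two quaternions with coordinates in `S`: they are
`S`-bilinear expressions in the coordinates (Mathlib's multiplication table
`QuaternionAlgebra.re_mul` & co.).  Vignéras, LNM 800, Ch. I §4 (orders). [folklore] -/
theorem equivTuple_mul_mem {R : Type*} [CommRing R] (S : Subring R) {c₁ c₂ c₃ : R}
    (h₁ : c₁ ∈ S) (h₂ : c₂ ∈ S) (h₃ : c₃ ∈ S) {x y : QuaternionAlgebra R c₁ c₂ c₃}
    (hx : ∀ i, QuaternionAlgebra.equivTuple c₁ c₂ c₃ x i ∈ S)
    (hy : ∀ i, QuaternionAlgebra.equivTuple c₁ c₂ c₃ y i ∈ S) :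
    ∀ i, QuaternionAlgebra.equivTuple c₁ c₂ c₃ (x * y) i ∈ S := by
  have hx0 : x.re ∈ S := by simpa using hx 0
  have hx1 : x.imI ∈ S := by simpa using hx 1
  have hx2 : x.imJ ∈ S := by simpa using hx 2
  have hx3 : x.imK ∈ S := by simpa using hx 3
  have hy0 : y.re ∈ S := by simpa using hy 0
  have hy1 : y.imI ∈ S := by simpa using hy 1
  have hy2 : y.imJ ∈ S := by simpa using hy 2
  have hy3 : y.imK ∈ S := by simpa using hy 3
  intro i
  fin_cases i <;>
    simp only [QuaternionAlgebra.equivTuple_apply, QuaternionAlgebra.re_mul,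
      QuaternionAlgebra.imI_mul, QuaternionAlgebra.imJ_mul, QuaternionAlgebra.imK_mul,
      Fin.mk_one, Fin.reduceFinMk, Matrix.cons_val_zero, Matrix.cons_val_one] <;>
    repeat' (first | assumption | apply add_mem | apply sub_mem | apply mul_mem)

/-- **`WindowDichotomy` holds** (stmt-Langlands-13535, proved outright): an additive
eigen-character of `Γ = O^×` trivial on the centre is either THETA-VISIBLE — and `ThetaVisibleConjA`
applies — or kills every theta-visible unit, hence (additivity on the subgroup `Γ`, closure
induction over the generators of `FTraceCongruenceGeneration`) kills the norm-one congruence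
subgroup `Γ¹(N)` — and `EisensteinConjA` applies. [folklore] -/
theorem windowDichotomy_proof :
    Summit.Langlands.Langlands.Theses.TorsionKudlaMillsonWindow.WindowDichotomy := by
  intro hTV hGen hEis F K _ _ _ _ _ σ a b hF h2 hσ hK ha hb hneg hpos a' b' hdiv IsInt IsG A _ _ HR PR
    c hadd hcen hHecke
  by_cases hvis : ∃ γ : (QuaternionAlgebra K a' 0 b')ˣ, (IsG γ ∧
      (γ : QuaternionAlgebra K a' 0 b') * star (γ : QuaternionAlgebra K a' 0 b') = 1 ∧
      σ (γ : QuaternionAlgebra K a' 0 b').re = (γ : QuaternionAlgebra K a' 0 b').re ∧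
      ¬ IsOfFinOrder γ) ∧ c γ ≠ 0
  · -- SPECIAL cell: theta-visible eigen-characters
    exact hTV F K σ a b hF h2 hσ hK ha hb hneg hpos hdiv A c hadd hcen hvis hHecke
  -- GENERIC cell: `c` kills every theta-visible unit.
  -- (1) `Γ = {u | IsG u}` is a subgroup of `B^×` (coordinate order `O_K⟨1,i,j,k⟩`, `a', b' ∈ O_F`).
  have ha' : a' ∈ (algebraMap (𝓞 K) K).range := ⟨algebraMap (𝓞 F) (𝓞 K) a, rfl⟩
  have hb' : b' ∈ (algebraMap (𝓞 K) K).range := ⟨algebraMap (𝓞 F) (𝓞 K) b, rfl⟩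
  have h0 : (0 : K) ∈ (algebraMap (𝓞 K) K).range := zero_mem _
  have hG1 : IsG 1 := by
    refine ⟨?_, ?_⟩
    · exact equivTuple_one_mem (algebraMap (𝓞 K) K).range a' 0 b'
    · rw [inv_one]
      exact equivTuple_one_mem (algebraMap (𝓞 K) K).range a' 0 b'
  have hGmul : ∀ u v, IsG u → IsG v → IsG (u * v) := by
    intro u v hu hv
    refine ⟨?_, ?_⟩
    · rw [Units.val_mul]
      exact equivTuple_mul_mem (algebraMap (𝓞 K) K).range ha' h0 hb' hu.1 hv.1
    · rw [mul_inv_rev, Units.val_mul]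
      exact equivTuple_mul_mem (algebraMap (𝓞 K) K).range ha' h0 hb' hv.2 hu.2
  have hGinv : ∀ u, IsG u → IsG u⁻¹ := fun u hu => ⟨hu.2, by rw [inv_inv]; exact hu.1⟩
  -- (2) `c` is a homomorphism on `Γ`: `c 1 = 0`, `c u⁻¹ = - c u`.
  have hc1 : c 1 = 0 := by
    have h := hadd 1 1 hG1 hG1
    rw [mul_one] at h
    linear_combination -h
  have hcinv : ∀ u, IsG u → c u⁻¹ = -c u := by
    intro u hu
    have h := hadd u u⁻¹ hu (hGinv u hu)
    rw [mul_inv_cancel, hc1] at h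
    linear_combination -h
  -- (3) closure induction over the generators of `FTraceCongruenceGeneration`.
  obtain ⟨N, hN, hgen⟩ := hGen F K σ a b hF h2 hσ hK ha hb hneg hpos hdiv
  refine hEis F K σ a b hF h2 hσ hK ha hb hneg hpos hdiv A c hadd hcen ⟨N, hN, fun γ hγ h1 => ?_⟩
    hHecke
  have key : IsG γ ∧ c γ = 0 := by
    refine Subgroup.closure_induction (p := fun x _ => IsG x ∧ c x = 0) ?_ ⟨hG1, hc1⟩ ?_ ?_
      (hgen γ hγ h1)
    · rintro x (hx | hx)
      · -- a theta-visible unit: killed by `c` in the generic cell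
        refine ⟨hx.1, ?_⟩
        by_contra hcx
        exact hvis ⟨x, hx, hcx⟩
      · -- a commutator `u v u⁻¹ v⁻¹` of `Γ`
        obtain ⟨u, v, hu, hv, rfl⟩ := hx
        have huv : IsG (u * v) := hGmul u v hu hv
        have huvu : IsG (u * v * u⁻¹) := hGmul _ _ huv (hGinv u hu)
        refine ⟨hGmul _ _ huvu (hGinv v hv), ?_⟩
        rw [hadd _ _ huvu (hGinv v hv), hadd _ _ huv (hGinv u hu), hadd u v hu hv, hcinv u hu,
          hcinv v hv]
        ring
    · intro x y _ _ hx hy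
      exact ⟨hGmul x y hx.1 hy.1, by rw [hadd x y hx.1 hy.1, hx.2, hy.2, add_zero]⟩
    · intro x _ hx
      exact ⟨hGinv x hx.1, by rw [hcinv x hx.1, hx.2, neg_zero]⟩
  exact key.2

end Summit.Langlands.Langlands.Theorems.TorsionKudlaMillsonWindowDichotomy
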